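import Summits.QuantumFields.QCD.Theses.PauliWegnerSea
import Literature.LinearAlgebra.Matrix.BorderedAdjugate

/-!
# Two-star port compression of the Wilson–Dirac determinant and cofactor block
# (helper for the crux `FibreCofactorDomination`, stmt-QuantumFields-11510, line `Sketch-ideator3`)

For a background `U`, two sites `x, y` and ANY gauge field `V` that agrees with `U` off the links of
`star x ∪ star y` (in particular the crux's `refit W`), split the quark indices into the `24`
indices at `{x, y}` (predicate `P p :↔ p.1 = x ∨ p.1 = y`) and the rest.  The exterior block
`D_V[¬P, ¬P]` does not see the star links, so it equals `E := D_U[¬P, ¬P]` for every refit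
(`wilsonDirac_apply_exterior`).  When `E` is invertible, the Schur-complement identities
`det D_V = det E · det S_V` and `adj(D_V) p q = det E · adj(S_V) p q` for `p, q ∈ {x,y}`-indices
hold with `S_V = D_V[P,P] - D_V[P,¬P] E⁻¹ D_V[¬P,P]` (`det_wilsonDirac_twoStar_schur`,
`adjugate_wilsonDirac_twoStar_schur`; Mathlib's `det_fromBlocks₂₂` and the tree's bordered-adjugate
lemma `Literature.LinearAlgebra.Matrix.adjugate_fromBlocks_inl_inl`).  Consequently the crux ratio
`sup_W ‖adj D(refit W)_{xy}‖ / sup_W |det D(refit W)|` at `(L, U, x, y)` equals the same ratio for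
the `W`-family of `24 × 24` Schur complements: the common factor `det E` is `W`-independent
(`det_refit_eq_mul`, `adjugate_refit_xy_eq_mul`).  Elementary; no analysis.
-/

noncomputable section

namespace Summit.QuantumFields.QCD.Theorems.RandomRefit

open scoped BigOperators Matrix
open MeasureTheory Filter Literature.MathematicalPhysics.QuantumFieldTheory
  Literature.MathematicalPhysics.QuantumLattice Literature.Probability.LatticeModels

variable {L : ℕ} [NeZero L]

-- the index split `{x,y}`-indices ⊕ rest needs a larger instance-size budget for `DecidableEq` of the sum
set_option synthInstance.maxSize 1024

omit [NeZero L] in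
/-- Off the two stars the Wilson–Dirac matrix does not see the star links: if `V` agrees with `U`
on every link not touching `x` or `y`, then `D_V p q = D_U p q` whenever neither `p` nor `q` sits
at `x` or `y`. -/
theorem wilsonDirac_apply_exterior
    (U V : GaugeConfig 4 L (Matrix.specialUnitaryGroup (Fin 3) ℂ)) (m₀ r : ℝ) (x y : TorusSite 4 L)
    (hV : ∀ e : Edge 4 L,
      ¬ (e.1 = x ∨ Site.shift e.1 e.2 = x ∨ e.1 = y ∨ Site.shift e.1 e.2 = y) → V e = U e)
    (p q : TorusSite 4 L × Fin 3 × Fin 4) (hp : ¬ (p.1 = x ∨ p.1 = y)) (hq : ¬ (q.1 = x ∨ q.1 = y)) :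
    wilsonDirac (fundamentalRep (Fin 3)) V m₀ r p q =
      wilsonDirac (fundamentalRep (Fin 3)) U m₀ r p q := by
  have h1 : ∀ μ : Fin 4, q.1 = Site.shift p.1 μ → V (p.1, μ) = U (p.1, μ) := by
    intro μ h
    refine hV _ ?_
    rintro (h' | h' | h' | h')
    · exact hp (Or.inl h')
    · dsimp only at h'
      rw [← h] at h'
      exact hq (Or.inl h')
    · exact hp (Or.inr h')
    · dsimp only at h'
      rw [← h] at h'
      exact hq (Or.inr h')
  have h2 : ∀ μ : Fin 4, p.1 = Site.shift q.1 μ → V (q.1, μ) = U (q.1, μ) := by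
    intro μ h
    refine hV _ ?_
    rintro (h' | h' | h' | h')
    · exact hq (Or.inl h')
    · dsimp only at h'
      rw [← h] at h'
      exact hp (Or.inl h')
    · exact hq (Or.inr h')
    · dsimp only at h'
      rw [← h] at h'
      exact hp (Or.inr h')
  simp only [wilsonDirac, Matrix.of_apply]
  congr 1
  congr 1
  refine Finset.sum_congr rfl fun μ _ => ?_
  congr 1
  · split_ifs with h
    · rw [h1 μ h]
    · rfl
  · split_ifs with h
    · rw [h2 μ h]
    · rfl

omit [NeZero L] in
/-- The crux's two-star refit `refit W e = if e touches x or y then W e else U e` agrees with `U`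
off the two stars. -/
theorem refit_apply_exterior
    (U W : GaugeConfig 4 L (Matrix.specialUnitaryGroup (Fin 3) ℂ)) (x y : TorusSite 4 L)
    (e : Edge 4 L) (he : ¬ (e.1 = x ∨ Site.shift e.1 e.2 = x ∨ e.1 = y ∨ Site.shift e.1 e.2 = y)) :
    (fun e : Edge 4 L =>
        if e.1 = x ∨ Site.shift e.1 e.2 = x ∨ e.1 = y ∨ Site.shift e.1 e.2 = y then W e else U e) e =
      U e := by
  dsimp only
  rw [if_neg he]

omit [NeZero L] in
/-- Block form of `D_V` along the split `{x,y}`-indices ⊕ rest: the three blocks touching `{x, y}`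
are those of `D_V`, the exterior block is that of `D_U`. -/
theorem wilsonDirac_submatrix_sumCompl
    (U V : GaugeConfig 4 L (Matrix.specialUnitaryGroup (Fin 3) ℂ)) (m₀ r : ℝ) (x y : TorusSite 4 L)
    (hV : ∀ e : Edge 4 L,
      ¬ (e.1 = x ∨ Site.shift e.1 e.2 = x ∨ e.1 = y ∨ Site.shift e.1 e.2 = y) → V e = U e) :
    (wilsonDirac (fundamentalRep (Fin 3)) V m₀ r).submatrix
        (Equiv.sumCompl fun p : TorusSite 4 L × Fin 3 × Fin 4 => p.1 = x ∨ p.1 = y)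
        (Equiv.sumCompl fun p : TorusSite 4 L × Fin 3 × Fin 4 => p.1 = x ∨ p.1 = y) =
      Matrix.fromBlocks
        ((wilsonDirac (fundamentalRep (Fin 3)) V m₀ r).toBlock (fun p => p.1 = x ∨ p.1 = y)
          (fun p => p.1 = x ∨ p.1 = y))
        ((wilsonDirac (fundamentalRep (Fin 3)) V m₀ r).toBlock (fun p => p.1 = x ∨ p.1 = y)
          (fun p => ¬ (p.1 = x ∨ p.1 = y)))
        ((wilsonDirac (fundamentalRep (Fin 3)) V m₀ r).toBlock (fun p => ¬ (p.1 = x ∨ p.1 = y))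
          (fun p => p.1 = x ∨ p.1 = y))
        ((wilsonDirac (fundamentalRep (Fin 3)) U m₀ r).toBlock (fun p => ¬ (p.1 = x ∨ p.1 = y))
          (fun p => ¬ (p.1 = x ∨ p.1 = y))) := by
  ext (i | i) (j | j)
  · rfl
  · rfl
  · rfl
  · simp only [Matrix.submatrix_apply, Equiv.sumCompl_apply_inr, Matrix.fromBlocks_apply₂₂,
      Matrix.toBlock_apply]
    exact wilsonDirac_apply_exterior U V m₀ r x y hV i.1 j.1 i.2 j.2

/-- **Port compression, determinant.**  If `V` agrees with `U` off the two stars and the exterior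
block `E = D_U[¬P,¬P]` has a unit determinant, then `det D_V = det E · det S_V` with the `24 × 24`
Schur complement `S_V = D_V[P,P] - D_V[P,¬P] E⁻¹ D_V[¬P,P]`, `P p :↔ p.1 = x ∨ p.1 = y`. -/
theorem det_wilsonDirac_twoStar_schur
    (U V : GaugeConfig 4 L (Matrix.specialUnitaryGroup (Fin 3) ℂ)) (m₀ r : ℝ) (x y : TorusSite 4 L)
    (hV : ∀ e : Edge 4 L,
      ¬ (e.1 = x ∨ Site.shift e.1 e.2 = x ∨ e.1 = y ∨ Site.shift e.1 e.2 = y) → V e = U e)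
    (hE : IsUnit ((wilsonDirac (fundamentalRep (Fin 3)) U m₀ r).toBlock
      (fun p : TorusSite 4 L × Fin 3 × Fin 4 => ¬ (p.1 = x ∨ p.1 = y))
      (fun p => ¬ (p.1 = x ∨ p.1 = y))).det) :
    (wilsonDirac (fundamentalRep (Fin 3)) V m₀ r).det =
      ((wilsonDirac (fundamentalRep (Fin 3)) U m₀ r).toBlock
          (fun p : TorusSite 4 L × Fin 3 × Fin 4 => ¬ (p.1 = x ∨ p.1 = y))
          (fun p => ¬ (p.1 = x ∨ p.1 = y))).det *
      ((wilsonDirac (fundamentalRep (Fin 3)) V m₀ r).toBlock (fun p => p.1 = x ∨ p.1 = y)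
            (fun p => p.1 = x ∨ p.1 = y) -
        (wilsonDirac (fundamentalRep (Fin 3)) V m₀ r).toBlock (fun p => p.1 = x ∨ p.1 = y)
            (fun p => ¬ (p.1 = x ∨ p.1 = y)) *
          ((wilsonDirac (fundamentalRep (Fin 3)) U m₀ r).toBlock (fun p => ¬ (p.1 = x ∨ p.1 = y))
            (fun p => ¬ (p.1 = x ∨ p.1 = y)))⁻¹ *
          (wilsonDirac (fundamentalRep (Fin 3)) V m₀ r).toBlock (fun p => ¬ (p.1 = x ∨ p.1 = y))
            (fun p => p.1 = x ∨ p.1 = y)).det := by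
  haveI := Matrix.invertibleOfIsUnitDet _ hE
  rw [← Matrix.det_submatrix_equiv_self
      (Equiv.sumCompl fun p : TorusSite 4 L × Fin 3 × Fin 4 => p.1 = x ∨ p.1 = y),
    wilsonDirac_submatrix_sumCompl U V m₀ r x y hV, Matrix.det_fromBlocks₂₂,
    Matrix.invOf_eq_nonsing_inv]

/-- **Port compression, cofactor block.**  Under the same hypotheses, every adjugate entry of `D_V`
with both indices at `x` or `y` is `det E` times the corresponding adjugate entry of the Schur
complement `S_V` — with NO invertibility assumption on `S_V`. -/
theorem adjugate_wilsonDirac_twoStar_schur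
    (U V : GaugeConfig 4 L (Matrix.specialUnitaryGroup (Fin 3) ℂ)) (m₀ r : ℝ) (x y : TorusSite 4 L)
    (hV : ∀ e : Edge 4 L,
      ¬ (e.1 = x ∨ Site.shift e.1 e.2 = x ∨ e.1 = y ∨ Site.shift e.1 e.2 = y) → V e = U e)
    (hE : IsUnit ((wilsonDirac (fundamentalRep (Fin 3)) U m₀ r).toBlock
      (fun p : TorusSite 4 L × Fin 3 × Fin 4 => ¬ (p.1 = x ∨ p.1 = y))
      (fun p => ¬ (p.1 = x ∨ p.1 = y))).det)
    (p q : TorusSite 4 L × Fin 3 × Fin 4) (hp : p.1 = x ∨ p.1 = y) (hq : q.1 = x ∨ q.1 = y) :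
    (wilsonDirac (fundamentalRep (Fin 3)) V m₀ r).adjugate p q =
      ((wilsonDirac (fundamentalRep (Fin 3)) U m₀ r).toBlock
          (fun p : TorusSite 4 L × Fin 3 × Fin 4 => ¬ (p.1 = x ∨ p.1 = y))
          (fun p => ¬ (p.1 = x ∨ p.1 = y))).det *
      ((wilsonDirac (fundamentalRep (Fin 3)) V m₀ r).toBlock (fun p => p.1 = x ∨ p.1 = y)
            (fun p => p.1 = x ∨ p.1 = y) -
        (wilsonDirac (fundamentalRep (Fin 3)) V m₀ r).toBlock (fun p => p.1 = x ∨ p.1 = y)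
            (fun p => ¬ (p.1 = x ∨ p.1 = y)) *
          ((wilsonDirac (fundamentalRep (Fin 3)) U m₀ r).toBlock (fun p => ¬ (p.1 = x ∨ p.1 = y))
            (fun p => ¬ (p.1 = x ∨ p.1 = y)))⁻¹ *
          (wilsonDirac (fundamentalRep (Fin 3)) V m₀ r).toBlock (fun p => ¬ (p.1 = x ∨ p.1 = y))
            (fun p => p.1 = x ∨ p.1 = y)).adjugate ⟨p, hp⟩ ⟨q, hq⟩ := by
  haveI := Matrix.invertibleOfIsUnitDet _ hE
  have h1 : (wilsonDirac (fundamentalRep (Fin 3)) V m₀ r).adjugate p q =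
      ((wilsonDirac (fundamentalRep (Fin 3)) V m₀ r).submatrix
        (Equiv.sumCompl fun p : TorusSite 4 L × Fin 3 × Fin 4 => p.1 = x ∨ p.1 = y)
        (Equiv.sumCompl fun p : TorusSite 4 L × Fin 3 × Fin 4 => p.1 = x ∨ p.1 = y)).adjugate
        (Sum.inl ⟨p, hp⟩) (Sum.inl ⟨q, hq⟩) := by
    rw [Matrix.adjugate_submatrix_equiv_self, Matrix.submatrix_apply, Equiv.sumCompl_apply_inl,
      Equiv.sumCompl_apply_inl]
  rw [h1, wilsonDirac_submatrix_sumCompl U V m₀ r x y hV,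
    Literature.LinearAlgebra.Matrix.adjugate_fromBlocks_inl_inl, Matrix.invOf_eq_nonsing_inv]

/-- **The crux's refit, determinant form.**  For the two-star refit of the crux
(`refit W e = if e.1 = x ∨ e.1 + ê₂ = x ∨ e.1 = y ∨ e.1 + ê₂ = y then W e else U e`) and an
exterior block with unit determinant: `det D(refit W) = det E · det S(W)` for EVERY `W`, the factor
`det E` not depending on `W`.  (Registered support signature `det_refit_eq_mul`.) -/
theorem det_refit_eq_mul : ∀ {L : ℕ} [NeZero L]
    (U W : GaugeConfig 4 L (Matrix.specialUnitaryGroup (Fin 3) ℂ)) (m₀ : ℝ) (x y : TorusSite 4 L),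
    IsUnit ((wilsonDirac (fundamentalRep (Fin 3)) U m₀ 1).toBlock
      (fun p : TorusSite 4 L × Fin 3 × Fin 4 => ¬ (p.1 = x ∨ p.1 = y))
      (fun p => ¬ (p.1 = x ∨ p.1 = y))).det →
    (wilsonDirac (fundamentalRep (Fin 3))
        (fun e => if e.1 = x ∨ Site.shift e.1 e.2 = x ∨ e.1 = y ∨ Site.shift e.1 e.2 = y
          then W e else U e) m₀ 1).det =
      ((wilsonDirac (fundamentalRep (Fin 3)) U m₀ 1).toBlock
          (fun p : TorusSite 4 L × Fin 3 × Fin 4 => ¬ (p.1 = x ∨ p.1 = y))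
          (fun p => ¬ (p.1 = x ∨ p.1 = y))).det *
      ((wilsonDirac (fundamentalRep (Fin 3))
          (fun e => if e.1 = x ∨ Site.shift e.1 e.2 = x ∨ e.1 = y ∨ Site.shift e.1 e.2 = y
            then W e else U e) m₀ 1).toBlock (fun p => p.1 = x ∨ p.1 = y)
            (fun p => p.1 = x ∨ p.1 = y) -
        (wilsonDirac (fundamentalRep (Fin 3))
          (fun e => if e.1 = x ∨ Site.shift e.1 e.2 = x ∨ e.1 = y ∨ Site.shift e.1 e.2 = y
            then W e else U e) m₀ 1).toBlock (fun p => p.1 = x ∨ p.1 = y)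
            (fun p => ¬ (p.1 = x ∨ p.1 = y)) *
          ((wilsonDirac (fundamentalRep (Fin 3)) U m₀ 1).toBlock (fun p => ¬ (p.1 = x ∨ p.1 = y))
            (fun p => ¬ (p.1 = x ∨ p.1 = y)))⁻¹ *
          (wilsonDirac (fundamentalRep (Fin 3))
            (fun e => if e.1 = x ∨ Site.shift e.1 e.2 = x ∨ e.1 = y ∨ Site.shift e.1 e.2 = y
              then W e else U e) m₀ 1).toBlock (fun p => ¬ (p.1 = x ∨ p.1 = y))
            (fun p => p.1 = x ∨ p.1 = y)).det :=
  fun U W m₀ x y hE =>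
    det_wilsonDirac_twoStar_schur U _ m₀ 1 x y (fun e he => refit_apply_exterior U W x y e he) hE

/-- **The crux's refit, cofactor form.**  The `(x, ·, ·), (y, ·, ·)` adjugate entries of `D(refit W)`
are `det E` times those of the `24 × 24` Schur complement `S(W)`, for every `W`. Hence, when the
exterior block is invertible, `Σ‖adj D(refit W)_{xy}‖ ≤ C · |det D(refit W')|` is literally
`Σ‖adj S(W)_{xy}‖ ≤ C · |det S(W')|` after cancelling `|det E| > 0`. -/
theorem adjugate_refit_xy_eq_mul
    (U W : GaugeConfig 4 L (Matrix.specialUnitaryGroup (Fin 3) ℂ)) (m₀ : ℝ) (x y : TorusSite 4 L)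
    (hE : IsUnit ((wilsonDirac (fundamentalRep (Fin 3)) U m₀ 1).toBlock
      (fun p : TorusSite 4 L × Fin 3 × Fin 4 => ¬ (p.1 = x ∨ p.1 = y))
      (fun p => ¬ (p.1 = x ∨ p.1 = y))).det)
    (a b : Fin 3) (i j : Fin 4) :
    (wilsonDirac (fundamentalRep (Fin 3))
        (fun e => if e.1 = x ∨ Site.shift e.1 e.2 = x ∨ e.1 = y ∨ Site.shift e.1 e.2 = y
          then W e else U e) m₀ 1).adjugate (x, a, i) (y, b, j) =
      ((wilsonDirac (fundamentalRep (Fin 3)) U m₀ 1).toBlock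
          (fun p : TorusSite 4 L × Fin 3 × Fin 4 => ¬ (p.1 = x ∨ p.1 = y))
          (fun p => ¬ (p.1 = x ∨ p.1 = y))).det *
      ((wilsonDirac (fundamentalRep (Fin 3))
          (fun e => if e.1 = x ∨ Site.shift e.1 e.2 = x ∨ e.1 = y ∨ Site.shift e.1 e.2 = y
            then W e else U e) m₀ 1).toBlock (fun p => p.1 = x ∨ p.1 = y)
            (fun p => p.1 = x ∨ p.1 = y) -
        (wilsonDirac (fundamentalRep (Fin 3))
          (fun e => if e.1 = x ∨ Site.shift e.1 e.2 = x ∨ e.1 = y ∨ Site.shift e.1 e.2 = y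
            then W e else U e) m₀ 1).toBlock (fun p => p.1 = x ∨ p.1 = y)
            (fun p => ¬ (p.1 = x ∨ p.1 = y)) *
          ((wilsonDirac (fundamentalRep (Fin 3)) U m₀ 1).toBlock (fun p => ¬ (p.1 = x ∨ p.1 = y))
            (fun p => ¬ (p.1 = x ∨ p.1 = y)))⁻¹ *
          (wilsonDirac (fundamentalRep (Fin 3))
            (fun e => if e.1 = x ∨ Site.shift e.1 e.2 = x ∨ e.1 = y ∨ Site.shift e.1 e.2 = y
              then W e else U e) m₀ 1).toBlock (fun p => ¬ (p.1 = x ∨ p.1 = y))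
            (fun p => p.1 = x ∨ p.1 = y)).adjugate
        ⟨(x, a, i), Or.inl rfl⟩ ⟨(y, b, j), Or.inr rfl⟩ :=
  adjugate_wilsonDirac_twoStar_schur U _ m₀ 1 x y (fun e he => refit_apply_exterior U W x y e he) hE
    (x, a, i) (y, b, j) (Or.inl rfl) (Or.inr rfl)


/-- **The crux at `(L, U, x, y)` is a statement about the `24 × 24` Schur family.**  When the
exterior block `E` of `D_U` has a unit determinant, the fibre-wise cofactor domination
`∀ W ∃ W', Σ ‖adj D(refit W)_{xy}‖ ≤ C ‖det D(refit W')‖` holds iff the same inequality, with the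
same constant, holds for the Schur complements `S(W)` (port compression: both sides carry the common
`W`-independent factor `‖det E‖ > 0`). -/
theorem refit_domination_iff_schur
    (U : GaugeConfig 4 L (Matrix.specialUnitaryGroup (Fin 3) ℂ)) (m₀ : ℝ) (x y : TorusSite 4 L)
    (hE : IsUnit ((wilsonDirac (fundamentalRep (Fin 3)) U m₀ 1).toBlock
          (fun p : TorusSite 4 L × Fin 3 × Fin 4 => ¬ (p.1 = x ∨ p.1 = y))
          (fun p => ¬ (p.1 = x ∨ p.1 = y))).det) (C : ℝ) :
    (∀ W : GaugeConfig 4 L (Matrix.specialUnitaryGroup (Fin 3) ℂ),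
      ∃ W' : GaugeConfig 4 L (Matrix.specialUnitaryGroup (Fin 3) ℂ),
        (∑ a : Fin 3, ∑ i : Fin 4, ∑ b : Fin 3, ∑ j : Fin 4,
          ‖(wilsonDirac (fundamentalRep (Fin 3)) (fun e => if e.1 = x ∨ Site.shift e.1 e.2 = x ∨ e.1 = y ∨ Site.shift e.1 e.2 = y
            then W e else U e) m₀ 1).adjugate (x, a, i) (y, b, j)‖) ≤
        C * ‖(wilsonDirac (fundamentalRep (Fin 3)) (fun e => if e.1 = x ∨ Site.shift e.1 e.2 = x ∨ e.1 = y ∨ Site.shift e.1 e.2 = y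
            then W' e else U e) m₀ 1).det‖) ↔
    (∀ W : GaugeConfig 4 L (Matrix.specialUnitaryGroup (Fin 3) ℂ),
      ∃ W' : GaugeConfig 4 L (Matrix.specialUnitaryGroup (Fin 3) ℂ),
        (∑ a : Fin 3, ∑ i : Fin 4, ∑ b : Fin 3, ∑ j : Fin 4,
          ‖((wilsonDirac (fundamentalRep (Fin 3)) (fun e => if e.1 = x ∨ Site.shift e.1 e.2 = x ∨ e.1 = y ∨ Site.shift e.1 e.2 = y
            then W e else U e) m₀ 1).toBlock (fun p => p.1 = x ∨ p.1 = y)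
            (fun p => p.1 = x ∨ p.1 = y) -
        (wilsonDirac (fundamentalRep (Fin 3)) (fun e => if e.1 = x ∨ Site.shift e.1 e.2 = x ∨ e.1 = y ∨ Site.shift e.1 e.2 = y
            then W e else U e) m₀ 1).toBlock (fun p => p.1 = x ∨ p.1 = y)
            (fun p => ¬ (p.1 = x ∨ p.1 = y)) *
          ((wilsonDirac (fundamentalRep (Fin 3)) U m₀ 1).toBlock
          (fun p : TorusSite 4 L × Fin 3 × Fin 4 => ¬ (p.1 = x ∨ p.1 = y))
          (fun p => ¬ (p.1 = x ∨ p.1 = y)))⁻¹ *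
          (wilsonDirac (fundamentalRep (Fin 3)) (fun e => if e.1 = x ∨ Site.shift e.1 e.2 = x ∨ e.1 = y ∨ Site.shift e.1 e.2 = y
            then W e else U e) m₀ 1).toBlock (fun p => ¬ (p.1 = x ∨ p.1 = y))
            (fun p => p.1 = x ∨ p.1 = y)).adjugate
            ⟨(x, a, i), Or.inl rfl⟩ ⟨(y, b, j), Or.inr rfl⟩‖) ≤
        C * ‖((wilsonDirac (fundamentalRep (Fin 3)) (fun e => if e.1 = x ∨ Site.shift e.1 e.2 = x ∨ e.1 = y ∨ Site.shift e.1 e.2 = y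
            then W' e else U e) m₀ 1).toBlock (fun p => p.1 = x ∨ p.1 = y)
            (fun p => p.1 = x ∨ p.1 = y) -
        (wilsonDirac (fundamentalRep (Fin 3)) (fun e => if e.1 = x ∨ Site.shift e.1 e.2 = x ∨ e.1 = y ∨ Site.shift e.1 e.2 = y
            then W' e else U e) m₀ 1).toBlock (fun p => p.1 = x ∨ p.1 = y)
            (fun p => ¬ (p.1 = x ∨ p.1 = y)) *
          ((wilsonDirac (fundamentalRep (Fin 3)) U m₀ 1).toBlock
          (fun p : TorusSite 4 L × Fin 3 × Fin 4 => ¬ (p.1 = x ∨ p.1 = y))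
          (fun p => ¬ (p.1 = x ∨ p.1 = y)))⁻¹ *
          (wilsonDirac (fundamentalRep (Fin 3)) (fun e => if e.1 = x ∨ Site.shift e.1 e.2 = x ∨ e.1 = y ∨ Site.shift e.1 e.2 = y
            then W' e else U e) m₀ 1).toBlock (fun p => ¬ (p.1 = x ∨ p.1 = y))
            (fun p => p.1 = x ∨ p.1 = y)).det‖) := by
  have hEpos : 0 < ‖((wilsonDirac (fundamentalRep (Fin 3)) U m₀ 1).toBlock
          (fun p : TorusSite 4 L × Fin 3 × Fin 4 => ¬ (p.1 = x ∨ p.1 = y))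
          (fun p => ¬ (p.1 = x ∨ p.1 = y))).det‖ := norm_pos_iff.mpr hE.ne_zero
  have hadj : ∀ (W : GaugeConfig 4 L (Matrix.specialUnitaryGroup (Fin 3) ℂ)),
      (∑ a : Fin 3, ∑ i : Fin 4, ∑ b : Fin 3, ∑ j : Fin 4,
          ‖(wilsonDirac (fundamentalRep (Fin 3)) (fun e => if e.1 = x ∨ Site.shift e.1 e.2 = x ∨ e.1 = y ∨ Site.shift e.1 e.2 = y
            then W e else U e) m₀ 1).adjugate (x, a, i) (y, b, j)‖) =
        ‖((wilsonDirac (fundamentalRep (Fin 3)) U m₀ 1).toBlock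
          (fun p : TorusSite 4 L × Fin 3 × Fin 4 => ¬ (p.1 = x ∨ p.1 = y))
          (fun p => ¬ (p.1 = x ∨ p.1 = y))).det‖ *
        (∑ a : Fin 3, ∑ i : Fin 4, ∑ b : Fin 3, ∑ j : Fin 4,
          ‖((wilsonDirac (fundamentalRep (Fin 3)) (fun e => if e.1 = x ∨ Site.shift e.1 e.2 = x ∨ e.1 = y ∨ Site.shift e.1 e.2 = y
            then W e else U e) m₀ 1).toBlock (fun p => p.1 = x ∨ p.1 = y)
            (fun p => p.1 = x ∨ p.1 = y) -
        (wilsonDirac (fundamentalRep (Fin 3)) (fun e => if e.1 = x ∨ Site.shift e.1 e.2 = x ∨ e.1 = y ∨ Site.shift e.1 e.2 = y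
            then W e else U e) m₀ 1).toBlock (fun p => p.1 = x ∨ p.1 = y)
            (fun p => ¬ (p.1 = x ∨ p.1 = y)) *
          ((wilsonDirac (fundamentalRep (Fin 3)) U m₀ 1).toBlock
          (fun p : TorusSite 4 L × Fin 3 × Fin 4 => ¬ (p.1 = x ∨ p.1 = y))
          (fun p => ¬ (p.1 = x ∨ p.1 = y)))⁻¹ *
          (wilsonDirac (fundamentalRep (Fin 3)) (fun e => if e.1 = x ∨ Site.shift e.1 e.2 = x ∨ e.1 = y ∨ Site.shift e.1 e.2 = y
            then W e else U e) m₀ 1).toBlock (fun p => ¬ (p.1 = x ∨ p.1 = y))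
            (fun p => p.1 = x ∨ p.1 = y)).adjugate
            ⟨(x, a, i), Or.inl rfl⟩ ⟨(y, b, j), Or.inr rfl⟩‖) := by
    intro W
    simp_rw [adjugate_refit_xy_eq_mul U W m₀ x y hE, norm_mul, Finset.mul_sum]
  have hdet : ∀ (W' : GaugeConfig 4 L (Matrix.specialUnitaryGroup (Fin 3) ℂ)),
      ‖(wilsonDirac (fundamentalRep (Fin 3)) (fun e => if e.1 = x ∨ Site.shift e.1 e.2 = x ∨ e.1 = y ∨ Site.shift e.1 e.2 = y
            then W' e else U e) m₀ 1).det‖ =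
        ‖((wilsonDirac (fundamentalRep (Fin 3)) U m₀ 1).toBlock
          (fun p : TorusSite 4 L × Fin 3 × Fin 4 => ¬ (p.1 = x ∨ p.1 = y))
          (fun p => ¬ (p.1 = x ∨ p.1 = y))).det‖ *
        ‖((wilsonDirac (fundamentalRep (Fin 3)) (fun e => if e.1 = x ∨ Site.shift e.1 e.2 = x ∨ e.1 = y ∨ Site.shift e.1 e.2 = y
            then W' e else U e) m₀ 1).toBlock (fun p => p.1 = x ∨ p.1 = y)
            (fun p => p.1 = x ∨ p.1 = y) -
        (wilsonDirac (fundamentalRep (Fin 3)) (fun e => if e.1 = x ∨ Site.shift e.1 e.2 = x ∨ e.1 = y ∨ Site.shift e.1 e.2 = y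
            then W' e else U e) m₀ 1).toBlock (fun p => p.1 = x ∨ p.1 = y)
            (fun p => ¬ (p.1 = x ∨ p.1 = y)) *
          ((wilsonDirac (fundamentalRep (Fin 3)) U m₀ 1).toBlock
          (fun p : TorusSite 4 L × Fin 3 × Fin 4 => ¬ (p.1 = x ∨ p.1 = y))
          (fun p => ¬ (p.1 = x ∨ p.1 = y)))⁻¹ *
          (wilsonDirac (fundamentalRep (Fin 3)) (fun e => if e.1 = x ∨ Site.shift e.1 e.2 = x ∨ e.1 = y ∨ Site.shift e.1 e.2 = y
            then W' e else U e) m₀ 1).toBlock (fun p => ¬ (p.1 = x ∨ p.1 = y))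
            (fun p => p.1 = x ∨ p.1 = y)).det‖ := by
    intro W'
    rw [det_refit_eq_mul U W' m₀ x y hE, norm_mul]
  simp_rw [hadj, hdet]
  constructor
  · intro h W
    obtain ⟨W', hW'⟩ := h W
    refine ⟨W', ?_⟩
    rw [mul_left_comm] at hW'
    exact le_of_mul_le_mul_left hW' hEpos
  · intro h W
    obtain ⟨W', hW'⟩ := h W
    refine ⟨W', ?_⟩
    rw [mul_left_comm]
    exact mul_le_mul_of_nonneg_left hW' hEpos.le

end Summit.QuantumFields.QCD.Theorems.RandomRefit
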